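import Mathlib
import Summits.Ventures.PercRepro2.LocRows
import Summits.Ventures.PercRepro2.SwRow
import Summits.Ventures.PercRepro2.SwOut
import Summits.Ventures.PercRepro2.SwAllRow
import Summits.Ventures.PercRepro2.SwOutAll

/-!
# The hull swap on the full-red configurations of an outside class (blind cell PercRepro2,
night-4 g10, 2026-08-25; proofs/NIGHT4-G10.md §3 (α))

On an outside class `outClass U h ξ` consider the configurations whose RED cluster of `h` is the
whole region `U`.  Flipping every edge touching `U` (`Hull.flip ends U`, the hull swap `σ_U`) maps
such a configuration to one of the same class whose BLUE cluster of `h` is `U`, exchanges the red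
and blue edge sets of the clusters of `h`, and keeps the conditioning `Q` (the red cluster of `l`
grows, the blue one shrinks, `h` stays disconnected from `l`).  Hence the full-red part of any class
satisfies the rigid counting inequality of (HLC) on its own (`card_fullRed_le`), with the explicit
injection `σ_U` — the «tied» pieces (α) of the base case of the cycle theorem.

* `wEdge_false_of_fullRed`: the outside edges of the region are blue;
* `cluster_flip_eq_cluster_blue`, `cluster_blue_flip_eq`: `C_R(h)(σζ) = C_B(h)(ζ)`, `C_B(h)(σζ) = U`;
* `flip_mem_outClass_of_fullRed`, `flip_mem_tgtU_of_fullRed`: the class and `Q` are kept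
  (`h_notMem_cluster_flip_of_outClass`: the swap never joins `h` to `l` in red, on any configuration
  of the class);
* `redEdges_flip_of_outClass`, `blueEdges_flip_of_fullRed`: the edge sets are exchanged;
* **`card_fullRed_le`**: the counting inequality on the full-red part.
-/

namespace Summit.Ventures.PercRepro2

namespace LocRows

open Hull

variable {V : Type*} {E : Type*} [Fintype E] [DecidableEq E]

open scoped Classical

variable {ends : E → Sym2 V}

section FullRed

variable {U : Set V} {h : V} {ζ : Config E}

omit [Fintype E] [DecidableEq E] in
/-- Every edge of `U` to the outside is blue when the red cluster of `h` is the whole region. -/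
lemma wEdge_false_of_fullRed (hT : cluster ends ζ h = U) {e : E} {x y : V} (hxy : ends e = s(x, y))
    (hx : x ∈ U) (hy : y ∉ U) : ζ e = false := by
  cases he : ζ e
  · rfl
  · exfalso
    apply hy
    rw [← hT] at hx ⊢
    exact mem_cluster_of_edge hx he hxy

omit [Fintype E] [DecidableEq E] in
/-- An edge at a vertex of `U` touches `U`. -/
lemma mem_touches_of_mem_left {e : E} {x y : V} (hxy : ends e = s(x, y)) (hx : x ∈ U) :
    e ∈ touches ends U := ⟨x, hx, y, hxy⟩

/-- The red cluster of `h` after the swap is the blue cluster of `h` before it (for every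
configuration of the class — the hull swap exchanges the two clusters of `h`). -/
theorem cluster_flip_eq_cluster_blue {ξ : Config E} (hζ : ζ ∈ outClass ends U h ξ) :
    cluster ends (flip ends U ζ) h = cluster ends (blue ζ) h := by
  have hTp : cluster ends (blue ζ) h ⊆ U := fun v hv => (mem_outClass.1 hζ).2 (Or.inr hv)
  have h1 : cluster ends (flip ends U ζ) h ⊆ cluster ends (blue ζ) h := by
    intro v hv
    refine mem_of_conn_of_closed (ends := ends) (ω := flip ends U ζ)
      (S := cluster ends (blue ζ) h) ?_ (mem_cluster_self _ _ _) hv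
    intro a ha b hab
    obtain ⟨_, e, he, hends⟩ := openGraph_adj.1 hab
    have hte : e ∈ touches ends U := mem_touches_of_mem_left hends (hTp ha)
    rw [flip_apply_of_mem hte] at he
    have he' : blue ζ e = true := by rw [blue_apply]; exact he
    exact mem_cluster_of_edge ha he' hends
  apply Set.Subset.antisymm h1
  intro v hv
  refine mem_of_conn_of_closed (ends := ends) (ω := blue ζ)
    (S := cluster ends (flip ends U ζ) h) ?_ (mem_cluster_self _ _ _) hv
  intro a ha b hab
  obtain ⟨_, e, he, hends⟩ := openGraph_adj.1 hab
  have haU : a ∈ U := hTp (h1 ha)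
  have hte : e ∈ touches ends U := mem_touches_of_mem_left hends haU
  have he' : flip ends U ζ e = true := by
    rw [flip_apply_of_mem hte]; rw [blue_apply] at he; exact he
  exact mem_cluster_of_edge ha he' hends

omit [Fintype E] [DecidableEq E] in
/-- The blue cluster of `h` after the swap is the whole region. -/
theorem cluster_blue_flip_eq (hT : cluster ends ζ h = U) :
    cluster ends (blue (flip ends U ζ)) h = U := by
  -- inside the region the blue colouring of the swap is the original colouring
  have hagree : ∀ e ∈ touches ends U, blue (flip ends U ζ) e = ζ e := by
    intro e he
    rw [blue_apply, flip_apply_of_mem he, Bool.not_not]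
  apply Set.Subset.antisymm
  · intro v hv
    refine mem_of_conn_of_closed (ends := ends) (ω := blue (flip ends U ζ)) (S := U) ?_
      (hT ▸ mem_cluster_self _ _ _) hv
    intro a ha b hab
    obtain ⟨_, e, he, hends⟩ := openGraph_adj.1 hab
    have hte : e ∈ touches ends U := mem_touches_of_mem_left hends ha
    rw [hagree e hte] at he
    rw [← hT] at ha ⊢
    exact mem_cluster_of_edge ha he hends
  · intro v hv
    rw [← hT] at hv
    refine mem_of_conn_of_closed (ends := ends) (ω := ζ)
      (S := cluster ends (blue (flip ends U ζ)) h ∩ U) ?_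
      ⟨mem_cluster_self _ _ _, hT ▸ mem_cluster_self _ _ _⟩ hv |>.1
    intro a ha b hab
    obtain ⟨_, e, he, hends⟩ := openGraph_adj.1 hab
    have hte : e ∈ touches ends U := mem_touches_of_mem_left hends ha.2
    refine ⟨mem_cluster_of_edge ha.1 (by rw [hagree e hte]; exact he) hends, ?_⟩
    rw [← hT]
    exact mem_cluster_of_edge (hT ▸ ha.2) he hends

/-- The swap of a full-red configuration of the class lies in the class. -/
theorem flip_mem_outClass_of_fullRed {ξ : Config E} (hζ : ζ ∈ outClass ends U h ξ)
    (hT : cluster ends ζ h = U) : flip ends U ζ ∈ outClass ends U h ξ := by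
  have hpin := (mem_outClass.1 hζ).1
  have hhull := (mem_outClass.1 hζ).2
  rw [mem_outClass]
  refine ⟨fun e he => ?_, ?_⟩
  · rw [flip_apply_of_notMem he]; exact hpin e he
  · intro v hv
    rcases hv with hv | hv
    · rw [cluster_flip_eq_cluster_blue hζ] at hv
      exact hhull (Or.inr hv)
    · rw [cluster_blue_flip_eq hT] at hv
      exact hv

end FullRed

section FullRedQ

variable {U : Set V} {l h o : V} {ζ : Config E}

omit [Fintype E] [DecidableEq E] in
/-- The red cluster of a vertex outside `U` stays outside `U` (the outside edges of `U` are blue). -/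
lemma cluster_subset_compl_of_fullRed (hT : cluster ends ζ h = U) {x : V} (hx : x ∉ U) :
    cluster ends ζ x ⊆ Uᶜ := by
  intro v hv
  refine mem_of_conn_of_closed (ends := ends) (ω := ζ) (S := Uᶜ) ?_ hx hv
  intro a ha b hab
  obtain ⟨_, e, he, hends⟩ := openGraph_adj.1 hab
  intro hb
  have := wEdge_false_of_fullRed hT (ends_swap hends) hb ha
  exact absurd (this.symm.trans he) (by simp)

omit [Fintype E] [DecidableEq E] in
/-- The blue cluster of a vertex outside `U` in the swap stays outside `U`. -/
lemma cluster_blue_flip_subset_compl_of_fullRed (hT : cluster ends ζ h = U) {x : V} (hx : x ∉ U) :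
    cluster ends (blue (flip ends U ζ)) x ⊆ Uᶜ := by
  intro v hv
  refine mem_of_conn_of_closed (ends := ends) (ω := blue (flip ends U ζ)) (S := Uᶜ) ?_ hx hv
  intro a ha b hab
  obtain ⟨_, e, he, hends⟩ := openGraph_adj.1 hab
  intro hb
  have hte : e ∈ touches ends U := mem_touches_of_mem_left (ends_swap hends) hb
  rw [blue_apply, flip_apply_of_mem hte, Bool.not_not] at he
  have := wEdge_false_of_fullRed hT (ends_swap hends) hb ha
  exact absurd (this.symm.trans he) (by simp)

omit [Fintype E] [DecidableEq E] in
/-- The red cluster of `l ∉ U` grows under the swap. -/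
lemma cluster_subset_cluster_flip_of_fullRed (hT : cluster ends ζ h = U) (hl : l ∉ U) :
    cluster ends ζ l ⊆ cluster ends (flip ends U ζ) l := by
  intro v hv
  refine mem_of_conn_of_closed (ends := ends) (ω := ζ)
    (S := {x | x ∉ U ∧ x ∈ cluster ends (flip ends U ζ) l}) ?_ ⟨hl, mem_cluster_self _ _ _⟩ hv |>.2
  intro a ha b hab
  obtain ⟨_, e, he, hends⟩ := openGraph_adj.1 hab
  have hbU : b ∉ U := fun hb =>
    absurd ((wEdge_false_of_fullRed hT (ends_swap hends) hb ha.1).symm.trans he) (by simp)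
  have hte : e ∉ touches ends U := by
    rintro ⟨x, hx, y, hxy⟩
    rw [hends, Sym2.eq_iff] at hxy
    rcases hxy with ⟨rfl, _⟩ | ⟨_, rfl⟩
    · exact ha.1 hx
    · exact hbU hx
  refine ⟨hbU, mem_cluster_of_edge ha.2 ?_ hends⟩
  rw [flip_apply_of_notMem hte]; exact he

omit [Fintype E] [DecidableEq E] in
/-- The blue cluster of `l ∉ U` shrinks under the swap. -/
lemma cluster_blue_flip_subset_cluster_blue_of_fullRed (hT : cluster ends ζ h = U) (hl : l ∉ U) :
    cluster ends (blue (flip ends U ζ)) l ⊆ cluster ends (blue ζ) l := by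
  intro v hv
  refine mem_of_conn_of_closed (ends := ends) (ω := blue (flip ends U ζ))
    (S := {x | x ∉ U ∧ x ∈ cluster ends (blue ζ) l}) ?_ ⟨hl, mem_cluster_self _ _ _⟩ hv |>.2
  intro a ha b hab
  obtain ⟨_, e, he, hends⟩ := openGraph_adj.1 hab
  have hbU : b ∉ U := by
    intro hb
    have hte : e ∈ touches ends U := mem_touches_of_mem_left (ends_swap hends) hb
    have he' := he
    rw [blue_apply, flip_apply_of_mem hte, Bool.not_not] at he'
    exact absurd ((wEdge_false_of_fullRed hT (ends_swap hends) hb ha.1).symm.trans he') (by simp)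
  have hte : e ∉ touches ends U := by
    rintro ⟨x, hx, y, hxy⟩
    rw [hends, Sym2.eq_iff] at hxy
    rcases hxy with ⟨rfl, _⟩ | ⟨_, rfl⟩
    · exact ha.1 hx
    · exact hbU hx
  refine ⟨hbU, mem_cluster_of_edge ha.2 ?_ hends⟩
  rw [blue_apply, flip_apply_of_notMem hte] at he
  rw [blue_apply]; exact he

/-- `h` is not red-connected to `l` in the swap (for every configuration of the class): a red path
of the swap entering the region does so at a vertex outside the blue cluster of `h` and cannot
reach it. -/
lemma h_notMem_cluster_flip_of_outClass {ξ : Config E} (hζ : ζ ∈ outClass ends U h ξ)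
    (hl : l ∉ U) (hhU : h ∈ U) :
    h ∉ cluster ends (flip ends U ζ) l := by
  intro hh
  have key : h ∈ {x | x ∉ U ∨ x ∉ cluster ends (blue ζ) h} := by
    refine mem_of_conn_of_closed (ends := ends) (ω := flip ends U ζ) ?_ (Or.inl hl) hh
    intro a ha b hab
    obtain ⟨_, e, he, hends⟩ := openGraph_adj.1 hab
    by_cases hbU : b ∈ U
    · right
      intro hbT
      -- the edge is blue in `ζ` (it touches `U`, red in the swap)
      have hte : e ∈ touches ends U := mem_touches_of_mem_left (ends_swap hends) hbU
      have hζe : ζ e = false := by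
        rw [flip_apply_of_mem hte] at he
        cases hζe : ζ e
        · rfl
        · rw [hζe] at he; exact absurd he (by decide)
      have hae : blue ζ e = true := by rw [blue_eq_true_iff]; exact hζe
      -- so `a` is in the blue cluster of `h` as well
      have haT : a ∈ cluster ends (blue ζ) h := mem_cluster_of_edge hbT hae (ends_swap hends)
      rcases ha with haU | haT'
      · -- `a ∉ U` but `a ∈ C_B(h)(ζ) ⊆ U` (hull condition)
        exact haU ((mem_outClass.1 hζ).2 (Or.inr haT))
      · exact haT' haT
    · exact Or.inl hbU
  rcases key with h' | h'
  · exact h' hhU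
  · exact h' (mem_cluster_self _ _ _)

/-- The swap of a full-red configuration of `Q` lies in `Q`. -/
theorem flip_mem_tgtU_of_fullRed {ξ : Config E} (hζ : ζ ∈ outClass ends U h ξ)
    (hT : cluster ends ζ h = U) (hl : l ∉ U) (hhU : h ∈ U)
    (hQ : ζ ∈ tgtU ends l h {S : Set V | o ∈ S}) :
    flip ends U ζ ∈ tgtU ends l h {S : Set V | o ∈ S} := by
  have hnotA : h ∉ cluster ends (flip ends U ζ) l := h_notMem_cluster_flip_of_outClass hζ hl hhU
  have hnotB : h ∉ cluster ends (blue (flip ends U ζ)) l := fun h' =>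
    (cluster_blue_flip_subset_compl_of_fullRed hT hl h') hhU
  have hA := cluster_subset_cluster_flip_of_fullRed (ends := ends) hT hl
  have hB := cluster_blue_flip_subset_cluster_blue_of_fullRed (ends := ends) hT hl
  simp only [tgtU, Finset.mem_filter, Finset.mem_univ, true_and, Set.mem_setOf_eq, hull,
    Set.mem_union, not_or] at hQ ⊢
  obtain ⟨_, hoA, hoB⟩ := hQ
  exact ⟨⟨hnotA, hnotB⟩, hA hoA, fun h' => hoB (hB h')⟩

/-- The red edges of the swap's red cluster are the blue edges of the blue cluster (for every
configuration of the class). -/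
theorem redEdges_flip_of_outClass {ξ : Config E} (hζ : ζ ∈ outClass ends U h ξ) :
    redEdges ends (flip ends U ζ) h = blueEdges ends ζ h := by
  have hTp : cluster ends (blue ζ) h ⊆ U := fun v hv => (mem_outClass.1 hζ).2 (Or.inr hv)
  ext e
  rw [blueEdges, mem_redEdges, mem_redEdges, cluster_flip_eq_cluster_blue hζ]
  constructor
  · rintro ⟨he, hw⟩
    refine ⟨?_, hw⟩
    obtain ⟨x, hx, y, _, hxy⟩ := hw
    have hte : e ∈ touches ends U := mem_touches_of_mem_left hxy (hTp hx)
    rw [flip_apply_of_mem hte] at he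
    rw [blue_apply]; exact he
  · rintro ⟨he, hw⟩
    refine ⟨?_, hw⟩
    obtain ⟨x, hx, y, _, hxy⟩ := hw
    have hte : e ∈ touches ends U := mem_touches_of_mem_left hxy (hTp hx)
    rw [flip_apply_of_mem hte]
    rw [blue_apply] at he; exact he

omit [Fintype E] [DecidableEq E] in
/-- The blue edges of the swap's blue cluster are the red edges of the red cluster. -/
theorem blueEdges_flip_of_fullRed (hT : cluster ends ζ h = U) :
    blueEdges ends (flip ends U ζ) h = redEdges ends ζ h := by
  ext e
  rw [blueEdges, mem_redEdges, mem_redEdges, cluster_blue_flip_eq hT, hT]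
  constructor
  · rintro ⟨he, hw⟩
    refine ⟨?_, hw⟩
    obtain ⟨x, hx, y, _, hxy⟩ := hw
    have hte : e ∈ touches ends U := mem_touches_of_mem_left hxy hx
    rw [blue_apply, flip_apply_of_mem hte, Bool.not_not] at he
    exact he
  · rintro ⟨he, hw⟩
    refine ⟨?_, hw⟩
    obtain ⟨x, hx, y, _, hxy⟩ := hw
    have hte : e ∈ touches ends U := mem_touches_of_mem_left hxy hx
    rw [blue_apply, flip_apply_of_mem hte, Bool.not_not]
    exact he

/-- **The full-red part of a class satisfies the rigid counting inequality on its own**: the hull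
swap injects it into the class, exchanging the edge sets. -/
theorem card_fullRed_le {ξ : Config E} (hl : l ∉ U) (hhU : h ∈ U) (𝓔 : Set (Set E)) :
    ((swOutSide ends l h o U ξ).filter fun ζ =>
        cluster ends ζ h = U ∧ redEdges ends ζ h ∈ 𝓔).card ≤
      ((swOutSide ends l h o U ξ).filter fun ζ => blueEdges ends ζ h ∈ 𝓔).card := by
  refine Finset.card_le_card_of_injOn (fun ζ => flip ends U ζ) ?_ ?_
  · intro ζ hζ
    rw [Finset.mem_coe, Finset.mem_filter] at hζ
    obtain ⟨hζ, hT, hE⟩ := hζ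
    rw [Finset.mem_coe, Finset.mem_filter]
    have hζ' := mem_swOutSide.1 hζ
    refine ⟨mem_swOutSide.2 ⟨flip_mem_tgtU_of_fullRed hζ'.2 hT hl hhU hζ'.1,
      flip_mem_outClass_of_fullRed hζ'.2 hT⟩, ?_⟩
    rw [blueEdges_flip_of_fullRed hT]; exact hE
  · intro ζ₁ _ ζ₂ _ heq
    have := congrArg (flip ends U) heq
    simpa only [Hull.flip_flip] using this

end FullRedQ

end LocRows

end Summit.Ventures.PercRepro2
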